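import Summits.ValiantsHypothesis.ValiantsHypothesis.Theorems.ToricFixedPoints.Negative.FormDeborderingG3Dc
import Literature.Computability.AlgebraicComplexity.LinSubst
import Literature.Computability.AlgebraicComplexity.StandardFamilies

/-!
# `ToricFixedPoints` / line `form_then_lift`, stub F1: the padded `G₃` is not End-type below size 7

Corollary of `determinantalComplexity_G3 : dc(G₃) = 7` (`FormDeborderingG3Dc`): for `3 ≤ m ≤ 6` the
padded form `ℓ^{m-3}·G₃(Y)` (`ℓ = X (0,0)`, `Y` the lower-right `3 × 3` block of the `m × m` variable
matrix) is NOT in `End(ℂ^{m²})·det_m` — a homogeneous End-orbit expression of size `m` would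
specialise (`ℓ ↦ 1`, `z ↦ 1`) to an affine determinantal representation of `G₃` of size `m < 7`.
Consequence for F1 (`stub_formDebordering`): at the two sizes `m ∈ {5, 6}` left open by the LMR dual
criterion and `dc(G₃) = 7`, IF `ℓ^{m-3}G₃` is a coefficientwise limit from `GL·det_m` then it is a
genuine border point (not End-type), so F1 could only hold for it through a non-End toric shape
`u·top_w(g·det_m)`; whether it is such a limit at all is open (numerically: no, kit job j294074 / lead
report c2 R7).  Refuter/theory seat `val-width-5779-d1` (stmt-ValiantsHypothesis-5779).  VP ≠ VNP is
not touched.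
-/

open MvPolynomial Finset
open Literature.Computability.AlgebraicComplexity

namespace Summit.ValiantsHypothesis.Cruxes.ToricFixedPoints.Negative

/-- **Specialising a homogeneous End-orbit expression gives an affine determinantal representation.**
If `A·det_m = F` (substitution of linear forms) and `g` assigns to every variable either a variable or
the constant `1`, then `aeval g F` has an affine determinantal representation of size `m`. [folklore] -/
theorem hasDetRepr_aeval_of_linSubst_detPoly_eq {τ : Type*} (m : ℕ)
    (A : Matrix (Fin m × Fin m) (Fin m × Fin m) ℂ) (F : MvPolynomial (Fin m × Fin m) ℂ)
    (hA : linSubst (Fin m × Fin m) ℂ A (detPoly (Fin m) ℂ) = F)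
    (g : Fin m × Fin m → MvPolynomial τ ℂ) (hg : ∀ p, (g p).totalDegree ≤ 1) :
    HasDetRepr (aeval g F) m := by
  classical
  refine ⟨(aeval g).mapMatrix ((linSubst (Fin m × Fin m) ℂ A).mapMatrix
    (Matrix.mvPolynomialX (Fin m) (Fin m) ℂ)), ?_, ?_⟩
  · intro i j
    simp only [AlgHom.mapMatrix_apply, Matrix.map_apply, Matrix.mvPolynomialX_apply, linSubst_X,
      map_sum, map_smul, aeval_X]
    refine (totalDegree_finsetSum _ _).trans (Finset.sup_le fun p _ => ?_)
    exact (totalDegree_smul_le _ _).trans (hg p)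
  · rw [← AlgHom.map_det, ← AlgHom.map_det]
    unfold detPoly at hA
    rw [hA]

/-- **The padded `G₃` is not End-type for `m ≤ 6`.**  For `3 ≤ m ≤ 6`,
`ℓ^{m-3}·(y₀₀y₁₁y₂₂ + y₀₁y₁₂y₂₀ + y₀₂y₁₀y₂₁) ∉ End(ℂ^{m²})·det_m`, because `dc(G₃) = 7`
(`determinantalComplexity_G3`). [folklore] -/
theorem paddedG3_not_mem_endOrbit (m : ℕ) [NeZero m] (hm : 3 ≤ m) (hm6 : m ≤ 6) :
    let y : Fin 3 → Fin 3 → MvPolynomial (Fin m × Fin m) ℂ :=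
      fun a b => X (⟨m - 3 + a, by omega⟩, ⟨m - 3 + b, by omega⟩)
    X ((0 : Fin m), (0 : Fin m)) ^ (m - 3) *
        (y 0 0 * y 1 1 * y 2 2 + y 0 1 * y 1 2 * y 2 0 + y 0 2 * y 1 0 * y 2 1) ∉
      endOrbit (Fin m × Fin m) ℂ (detPoly (Fin m) ℂ) := by
  intro y hmem
  obtain ⟨A, hA⟩ := hmem
  dsimp only at hA
  -- specialisation: block variables to the `3 × 3` variables, everything else to `1`
  let g : Fin m × Fin m → MvPolynomial (Fin 3 × Fin 3) ℂ := fun p =>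
    if h : m - 3 ≤ (p.1 : ℕ) ∧ m - 3 ≤ (p.2 : ℕ) then
      X (⟨(p.1 : ℕ) - (m - 3), by omega⟩, ⟨(p.2 : ℕ) - (m - 3), by omega⟩)
    else 1
  have hg : ∀ p, (g p).totalDegree ≤ 1 := by
    intro p
    simp only [g]
    split_ifs
    · exact (totalDegree_X _).le
    · simp
  have hgy : ∀ a b : Fin 3, aeval g (y a b) = (X (a, b) : MvPolynomial (Fin 3 × Fin 3) ℂ) := by
    intro a b
    simp only [y, aeval_X, g]
    rw [dif_pos ⟨by simp, by simp⟩]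
    congr 2 <;> ext <;> simp
  have hℓ : aeval g ((X ((0 : Fin m), (0 : Fin m)) : MvPolynomial (Fin m × Fin m) ℂ) ^ (m - 3)) =
      1 := by
    rcases Nat.eq_or_lt_of_le hm with h3 | h4
    · subst h3; simp
    · rw [map_pow, aeval_X]
      have : g ((0 : Fin m), (0 : Fin m)) = 1 := by
        simp only [g]
        rw [dif_neg]
        simp only [Fin.val_zero, nonpos_iff_eq_zero, not_and]
        omega
      rw [this, one_pow]
  have hrepr := hasDetRepr_aeval_of_linSubst_detPoly_eq m A _ hA g hg
  rw [map_mul, hℓ, one_mul] at hrepr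
  simp only [map_add, map_mul, hgy] at hrepr
  have h7 := seven_le_determinantalComplexity_G3 ℂ
  have h6 := determinantalComplexity_le_of_hasDetRepr hrepr
  omega

end Summit.ValiantsHypothesis.Cruxes.ToricFixedPoints.Negative
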